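import Summits.Ventures.PercRepro.ProfileGapMonoColoopBandSucc

/-!
# PercRepro — THE WEAK AVERAGED STEP OF THE THRESHOLD FAMILY: `Σ_z Φ_t(N ∖ z) ≤ #E · Φ_t(N)`
(p5, gen 26; `proofs/P5-GM1.md` §25(r); announced INBOX 12583)

`WeakAvgStepT α q t` is the averaged deletion step of the threshold gap
`Φ_t(N) = q · #{S : ρ(S) = q, ρ(E∖S) ≥ t} − thresholdSum N q t` with the coefficient `#E` (not `#E − q` as in
`AvgStepT`, `ProfileGapMonoRowAvg`): `Σ_{z ∈ E} Φ_t(N ∖ z) ≤ #E · Φ_t(N)` for every finite matroid, written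
without subtraction.  It is a CONJECTURE, NOT asserted here: exhaustively true on EVERY matroid on `≤ 9` elements
at `t ∈ {q − 1, q, q + 1}` (0 failures on 1,147,346 / 1,147,346 / 955,787 instances at `n = 9`, loops, parallel
pairs and coloops included) and on the 850 ten-element offenders of the band case, false at `t = q + 2`.  It is
the `(#E − q)`-step plus `q · Φ_t(N)`; the `(#E − q)`-step fails at `t = q + 1` (`U_{2,3} ⊕ U_{2,3}`), this one is
tight there.  Its content is one line: a nonempty ground set with `Σ_z Δ_z ≥ 0` has a point with `Δ_z ≥ 0`, so the
weak averaged step gives the deletion rule `DelMonoRuleT` on EVERY matroid (`delMonoRuleT_of_weakAvgStepT`) —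
no hard class, no choice of a point — and hence `(I_t)` on every finite matroid through the kernel's induction
(`thresholdIneq_of_weakAvgStepT`); at `(q, t) = (3, 4)` it gives `(★_3)` at `u = 4` and `(GM)_3` at every coloop at
`u = 4` from the single instance `WeakAvgStepT α 3 4`.

* `WeakAvgStepT` (conjecture def), **`exists_delMonoT_of_weakAvg`**, **`delMonoRuleT_of_weakAvgStepT`**,
  **`thresholdIneq_of_weakAvgStepT`**, `thresholdIneq_three_four_of_weakAvg`, `starQ_three_four_of_weakAvg`,
  `gapMonoQ_coloop_three_four_of_weakAvg`, `gapMonoQ_coloop_succ_of_weakAvg`.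
-/

open scoped Matroid

namespace PercRepro.Cogirth

open Finset ThmH Skew Shadow Profile

variable {α : Type} [DecidableEq α] {M : Matroid α} [M.Finite]

section WeakAvg

variable {q t : ℕ}

/-- **The weak averaged deletion step of the threshold gap** (a CONJECTURE at `t ≤ q + 1`, NOT asserted):
`Σ_{z ∈ E} Φ_t(N ∖ z) ≤ #E · Φ_t(N)` for every finite matroid, written without subtraction —
`Σ_z q · #T_t(N ∖ z) + #E · thresholdSum N q t ≤ Σ_z thresholdSum (N ∖ z) q t + #E · q · #T_t(N)`. -/
def WeakAvgStepT (α : Type) [DecidableEq α] (q t : ℕ) : Prop :=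
  ∀ (N : Matroid α) [N.Finite],
    ∑ z ∈ gr N, q * (levelSetCoQ (N ＼ ({z} : Set α)) t q).card + (gr N).card * thresholdSum N q t ≤
      ∑ z ∈ gr N, thresholdSum (N ＼ ({z} : Set α)) q t + (gr N).card * (q * (levelSetCoQ N t q).card)

/-- **Pigeonhole**: if `Σ_{z ∈ E} Φ_t(N ∖ z) ≤ #E · Φ_t(N)` and `E ≠ ∅`, some point is deletion-monotone
(if every `Δ_z` were negative, the sum over the nonempty ground set would be). -/
theorem exists_delMonoT_of_weakAvg {N : Matroid α} [N.Finite] (hne : (gr N).Nonempty)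
    (h : ∑ z ∈ gr N, q * (levelSetCoQ (N ＼ ({z} : Set α)) t q).card + (gr N).card * thresholdSum N q t ≤
      ∑ z ∈ gr N, thresholdSum (N ＼ ({z} : Set α)) q t + (gr N).card * (q * (levelSetCoQ N t q).card)) :
    ∃ z ∈ gr N, DelMonoT N z q t := by
  by_contra hcon
  push Not at hcon
  have hlt : ∀ z ∈ gr N,
      thresholdSum (N ＼ ({z} : Set α)) q t + q * (levelSetCoQ N t q).card <
        thresholdSum N q t + q * (levelSetCoQ (N ＼ ({z} : Set α)) t q).card := by
    intro z hz
    have hz' := hcon z hz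
    unfold DelMonoT at hz'
    omega
  have hsum := sum_lt_sum_of_nonempty hne hlt
  rw [sum_add_distrib, sum_add_distrib, sum_const, sum_const, smul_eq_mul, smul_eq_mul] at hsum
  omega

/-- **The weak averaged step gives the deletion rule on every matroid.** -/
theorem delMonoRuleT_of_weakAvgStepT (h : WeakAvgStepT α q t) : DelMonoRuleT α q t :=
  fun N _ hne => exists_delMonoT_of_weakAvg hne (h N)

/-- **`(I_t)` on every finite matroid from the weak averaged step** (through `thresholdIneq_of_delMonoRuleT`). -/
theorem thresholdIneq_of_weakAvgStepT (h : WeakAvgStepT α q t) (M : Matroid α) [M.Finite] :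
    ThresholdIneq M q t :=
  thresholdIneq_of_delMonoRuleT (delMonoRuleT_of_weakAvgStepT h) M

/-- **`(GM)_q` at every coloop at the level `u = q + 1` from the weak averaged step at `t = q + 1`** (`1 ≤ q`). -/
theorem gapMonoQ_coloop_succ_of_weakAvg {z : α} (hz : z ∈ gr M)
    (hzc : rk M ((gr M).erase z) + 1 = rk M (gr M)) (hq : 1 ≤ q) (h : WeakAvgStepT α q (q + 1)) :
    GapMonoQ M z q (q + 1) :=
  gapMonoQ_of_coloop_succ_of_rule hz hzc hq (delMonoRuleT_of_weakAvgStepT h)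

end WeakAvg

section ThreeFour

/-- **`(I_4)` at co-rank `3` on every finite matroid from the single instance `WeakAvgStepT α 3 4`.** -/
theorem thresholdIneq_three_four_of_weakAvg (h : WeakAvgStepT α 3 4) (N : Matroid α) [N.Finite] :
    ThresholdIneq N 3 4 :=
  thresholdIneq_of_weakAvgStepT h N

/-- **`(★_3)` at `u = 4` from the single instance `WeakAvgStepT α 3 4`.** -/
theorem starQ_three_four_of_weakAvg {z : α} (h : WeakAvgStepT α 3 4) : StarQ M z 3 4 :=
  (starQ_succ_iff_thresholdIneq (by norm_num)).2 (thresholdIneq_three_four_of_weakAvg h _)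

/-- **`(GM)_3` at every coloop at the level `u = 4` from the single instance `WeakAvgStepT α 3 4`** — the first
hard instance of the coloop band case, from one averaged inequality on every matroid. -/
theorem gapMonoQ_coloop_three_four_of_weakAvg {z : α} (hz : z ∈ gr M)
    (hzc : rk M ((gr M).erase z) + 1 = rk M (gr M)) (h : WeakAvgStepT α 3 4) : GapMonoQ M z 3 4 :=
  gapMonoQ_coloop_succ_of_weakAvg hz hzc (by norm_num) h

end ThreeFour

end PercRepro.Cogirth
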